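import Summits.KontsevichZagierPeriods.Zeta5Search.Barrier.ConeGammaCuspPeriodCanonicalCones
import Literature.Analysis.Convex.LinearProgrammingDuality

/-!
# ζ(5) search — BARRIER: GORDAN'S ALTERNATIVE FOR THE CUSP SLOPE — the hull certificate EXISTS at every cusp top

HONEST FRAMING (cell `pub-zeta5`): systematic search; no irrationality claim unless kernel-certified. MODEL objects
under Brown–Zudilin's (28)+(30) accounting ([BZ22] = arXiv:2210.03391; (28) observed, not proved); nothing here is a
statement about `ζ(5)`, any `γ` of record, the cone's supremum (C2 OPEN) or the value / sign of the cusp slope, of a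
chamber weight or of a certificate at a named direction (DATA of the cell); NO certificate instance is asserted for any
named direction (at record/41, flag/60, argmax-120, t*/480 ascent directions exist — DATA); S-E stays CONJECTURED;
records in print UNMOVED. Prover P2 g34, item «GORDAN'S ALTERNATIVE FOR THE CUSP SLOPE» (P2 g31–g33's successor menu (b)
«Gordan's converse», which `ConeGammaCuspPeriodCertificate` left unclaimed), file (1) of 2 (theorems only).

THE POINT. P2 g31's HULL CERTIFICATE (`cuspSlope_nonpos_of_hull_certificate`): finitely many generic references `δ₀^j`
and weights `t_j ≥ 0`, `Σ t_j > 0`, with `Σ_j t_j·G_j ≡ 0` (`G_j(δ) = Σ_k W_k(δ₀^j)·φ_k(δ)/h_k(a)` the chamber functional)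
give `σ ≤ 0` in every direction WHEN the period pattern function `F` is supermodular. This file proves the other half,
for ANY `F` and with no type hypothesis where none is needed:
* `gordan_alternative` — the theorem of the alternative behind it, for any family of functionals on `ℝ⁸` linear in
  the 8 coordinates whose gradients over the admissible references form a finite set: EITHER some displacement makes
  every admissible functional positive, OR zero is a convex combination of finitely many admissible gradients — the
  tree's `Literature.Analysis.Convex.LPDuality.gordan_transposition` (Schrijver 1986 §7.8 (31)) applied to the finite
  gradient matrix; `not_uniform_pos_of_hull_certificate` — never both;
* `chamber_gradients_finite` — the chamber gradients of ANY set function `F` on the 28 forms at ANY direction form a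
  finite set (a gradient depends on the reference only through its 28 pairs of prefix sets);
* **`exists_uniform_ascent_or_hull_certificate`** — GORDAN'S ALTERNATIVE FOR THE CHAMBER FUNCTIONALS (any `F`, any `a`):
  either there is ONE displacement `δ` with `G_{δ₀}(δ) > 0` for EVERY generic reference `δ₀` (a UNIFORM ascent
  displacement — by `cuspSlope_pos_of_forall_greedy_pos` an ascent direction of `σ`), or the hull certificate exists;
* **`hull_certificate_of_forall_cuspSlope_nonpos`** — THE HULL CONDITION IS NECESSARY AT A CUSP TOP, FOR ANY TYPE: with
  the data of `cuspSlope_eq_lovasz_period` (`hf`, `hF` — junction pattern functions of any extension), if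
  `cuspSlope a T δ ≤ 0` for every `δ` then finitely many generic references and weights with `Σ t_j G_j ≡ 0` EXIST;
* **`forall_cuspSlope_nonpos_iff_hull_certificate_of_supermodular`** — GORDAN'S CONVERSE proper: for supermodular `F`,
  «`σ ≤ 0` in every direction» is EQUIVALENT to the existence of the hull certificate (P2 g31 (3) ⇐, this file ⇒).
What this is NOT: for `F` of no pure type (the case at the four named directions — DATA) the hull condition is necessary,
not sufficient; no certificate is computed or asserted at any named direction (P2 g31's desk (L4) found hull supports of
size 8 at all four — DATA, consistent with necessity and certifying nothing); nothing about `γ`, C2, S-E or `ζ(5)`.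
-/

noncomputable section

open Set MeasureTheory Finset
open scoped Topology

namespace Summit.KontsevichZagierPeriods.Zeta5Search.Barrier.ConeGamma

/-! ### The theorem of the alternative for a finite family of gradients in `ℝ⁸` -/

/-- **GORDAN'S ALTERNATIVE (the form used by the cusp chain).** `G δ₀` a functional on the displacements attached
to every reference `δ₀ ∈ ℝ⁸`, linear in the 8 coordinates (`G δ₀ δ = Σ_p δ_p · G δ₀ e_p`), whose GRADIENTS `(G δ₀ e_p)_p`
over the admissible references (`P δ₀`) form a finite set. Then EITHER some displacement `δ` has `G δ₀ δ > 0` for every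
admissible `δ₀`, OR there are finitely many admissible references `δ₀ ∈ s` and weights `t ≥ 0` with `Σ t > 0` and
`Σ_{δ₀∈s} t δ₀ · G δ₀ ≡ 0` (zero in the convex hull of the admissible gradients). This is the tree's transposition theorem
of Gordan (`Literature.Analysis.Convex.LPDuality.gordan_transposition`, Schrijver 1986 §7.8 (31): «`x ≥ 0`, `x ≠ 0`,
`Ax = 0` is solvable iff no `y` has `yA > 0`») applied to the matrix whose columns are the finitely many admissible
gradients, the weights on gradients being pushed to references behind them. -/
theorem gordan_alternative (G : (Fin 8 → ℝ) → (Fin 8 → ℝ) → ℝ) (P : (Fin 8 → ℝ) → Prop)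
    (hlin : ∀ δ₀ δ, G δ₀ δ = ∑ p, δ p * G δ₀ (Pi.single p (1 : ℝ)))
    (hfin : ((fun δ₀ : Fin 8 → ℝ => fun p : Fin 8 => G δ₀ (Pi.single p (1 : ℝ))) '' {δ₀ | P δ₀}).Finite) :
    (∃ δ : Fin 8 → ℝ, ∀ δ₀, P δ₀ → 0 < G δ₀ δ) ∨
      ∃ (s : Finset (Fin 8 → ℝ)) (t : (Fin 8 → ℝ) → ℝ), (∀ δ₀ ∈ s, P δ₀) ∧ (∀ δ₀ ∈ s, 0 ≤ t δ₀) ∧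
        0 < ∑ δ₀ ∈ s, t δ₀ ∧ ∀ δ : Fin 8 → ℝ, ∑ δ₀ ∈ s, t δ₀ * G δ₀ δ = 0 := by
  classical
  -- the gradient of a reference and the finite set `T` of admissible gradients
  obtain ⟨v, hv⟩ : ∃ v : (Fin 8 → ℝ) → Fin 8 → ℝ, ∀ δ₀ p, v δ₀ p = G δ₀ (Pi.single p (1 : ℝ)) :=
    ⟨_, fun _ _ => rfl⟩
  have hvf : (fun δ₀ : Fin 8 → ℝ => fun p : Fin 8 => G δ₀ (Pi.single p (1 : ℝ))) = v := by
    funext δ₀ p; rw [hv]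
  rw [hvf] at hfin
  have hG : ∀ δ₀ δ, G δ₀ δ = ∑ p, δ p * v δ₀ p := fun δ₀ δ => by simp only [hv]; exact hlin δ₀ δ
  set T := hfin.toFinset with hT
  have hmemT : ∀ δ₀, P δ₀ → v δ₀ ∈ T := fun δ₀ hP => hfin.mem_toFinset.mpr ⟨δ₀, hP, rfl⟩
  have hback : ∀ y ∈ T, ∃ δ₀, P δ₀ ∧ v δ₀ = y := fun y hy => by
    simpa only [hT, Set.Finite.mem_toFinset, Set.mem_image, Set.mem_setOf_eq] using hy
  choose! ref href using hback
  -- Gordan's transposition theorem for the `8 × T` matrix of admissible gradients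
  have hGordan := Literature.Analysis.Convex.LPDuality.gordan_transposition (𝕜 := ℝ)
    (fun (p : Fin 8) (y : ↥T) => (y : Fin 8 → ℝ) p : Matrix (Fin 8) ↥T ℝ)
  by_cases hx : ∃ x : ↥T → ℝ, 0 ≤ x ∧ x ≠ 0 ∧
      Matrix.mulVec (fun (p : Fin 8) (y : ↥T) => (y : Fin 8 → ℝ) p : Matrix (Fin 8) ↥T ℝ) x = 0
  · -- non-trivial non-negative weights on the gradients combining to zero: push them to references
    right
    obtain ⟨x, hx0, hxne, hAx⟩ := hx
    have hAx' : ∀ p, ∑ y : ↥T, (y : Fin 8 → ℝ) p * x y = 0 := fun p => by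
      have := congrFun hAx p
      simpa only [Matrix.mulVec, dotProduct, Pi.zero_apply] using this
    have hmaps : ∀ y ∈ T.attach, ref y ∈ T.image ref := fun y _ => Finset.mem_image_of_mem ref y.2
    refine ⟨T.image ref, fun δ₀ => ∑ y ∈ T.attach.filter (fun y : ↥T => ref (y : Fin 8 → ℝ) = δ₀), x y, ?_, ?_, ?_, fun δ => ?_⟩
    · intro δ₀ hδ₀
      obtain ⟨y, hy, rfl⟩ := Finset.mem_image.mp hδ₀
      exact (href y hy).1
    · exact fun δ₀ _ => Finset.sum_nonneg fun y _ => hx0 y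
    · dsimp only
      rw [Finset.sum_fiberwise_of_maps_to hmaps x]
      obtain ⟨y₀, hy₀⟩ : ∃ y, x y ≠ 0 := by
        by_contra h
        push Not at h
        exact hxne (funext h)
      exact Finset.sum_pos' (fun y _ => hx0 y) ⟨y₀, Finset.mem_attach _ _, (hx0 y₀).lt_of_ne hy₀.symm⟩
    · dsimp only
      have e : ∀ δ₀ ∈ T.image ref, (∑ y ∈ T.attach.filter (fun y : ↥T => ref (y : Fin 8 → ℝ) = δ₀), x y) * G δ₀ δ =
          ∑ y ∈ T.attach.filter (fun y : ↥T => ref (y : Fin 8 → ℝ) = δ₀), x y * G (ref y) δ := fun δ₀ _ => by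
        rw [Finset.sum_mul]
        exact Finset.sum_congr rfl fun y hy => by rw [(Finset.mem_filter.mp hy).2]
      rw [Finset.sum_congr rfl e, Finset.sum_fiberwise_of_maps_to hmaps (fun y => x y * G (ref y) δ)]
      calc ∑ y ∈ T.attach, x y * G (ref y) δ = ∑ y ∈ T.attach, x y * ∑ p, δ p * (y : Fin 8 → ℝ) p :=
            Finset.sum_congr rfl fun y _ => by rw [hG, (href y y.2).2]
        _ = ∑ p, δ p * ∑ y : ↥T, (y : Fin 8 → ℝ) p * x y := by
            rw [← Finset.univ_eq_attach]
            simp_rw [Finset.mul_sum]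
            rw [Finset.sum_comm]
            exact Finset.sum_congr rfl fun p _ => Finset.sum_congr rfl fun y _ => by ring
        _ = 0 := Finset.sum_eq_zero fun p _ => by rw [hAx' p, mul_zero]
  · -- otherwise (Gordan) some `y` pairs positively with every admissible gradient
    left
    have hy : ∃ y : Fin 8 → ℝ, ∀ j : ↥T,
        0 < Matrix.vecMul y (fun (p : Fin 8) (y : ↥T) => (y : Fin 8 → ℝ) p : Matrix (Fin 8) ↥T ℝ) j := by
      by_contra h
      exact hx (hGordan.mpr h)
    obtain ⟨y, hy⟩ := hy
    refine ⟨y, fun δ₀ hP => ?_⟩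
    have h := hy ⟨v δ₀, hmemT δ₀ hP⟩
    rw [hG]
    simpa only [Matrix.vecMul, dotProduct] using h

/-- **Never both**: a hull certificate (`t ≥ 0`, `Σ t > 0`, `Σ t δ₀ · G δ₀ ≡ 0` over admissible references) excludes a
displacement at which every admissible functional is positive. -/
theorem not_uniform_pos_of_hull_certificate (G : (Fin 8 → ℝ) → (Fin 8 → ℝ) → ℝ) (P : (Fin 8 → ℝ) → Prop)
    {s : Finset (Fin 8 → ℝ)} {t : (Fin 8 → ℝ) → ℝ} (hP : ∀ δ₀ ∈ s, P δ₀) (ht : ∀ δ₀ ∈ s, 0 ≤ t δ₀)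
    (htpos : 0 < ∑ δ₀ ∈ s, t δ₀) (hzero : ∀ δ : Fin 8 → ℝ, ∑ δ₀ ∈ s, t δ₀ * G δ₀ δ = 0) :
    ¬ ∃ δ : Fin 8 → ℝ, ∀ δ₀, P δ₀ → 0 < G δ₀ δ := by
  rintro ⟨δ, hδ⟩
  obtain ⟨j, hj, htj⟩ : ∃ j ∈ s, 0 < t j := by
    by_contra h
    push Not at h
    exact (Finset.sum_nonpos h).not_gt htpos
  have hlt : 0 < ∑ δ₀ ∈ s, t δ₀ * G δ₀ δ :=
    Finset.sum_pos' (fun i hi => mul_nonneg (ht i hi) (hδ i (hP i hi)).le) ⟨j, hj, mul_pos htj (hδ j (hP j hj))⟩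
  exact hlt.ne' (hzero δ)

/-! ### The chamber gradients of a set function on the 28 forms -/

/-- **THE CHAMBER GRADIENTS FORM A FINITE SET** (any set function `F` on the 28 forms, any direction `a`): the gradient
of the chamber functional of a reference `δ₀` — the vector of its values `Σ_k W_k(δ₀)·φ_k(e_p)/h_k(a)` on the 8 coordinate
displacements, `W_k(δ₀) = F(P≤(k)) − F(P<(k))` — depends on `δ₀` only through its 28 pairs of prefix sets, so only
finitely many gradients occur over all of `ℝ⁸`. -/
theorem chamber_gradients_finite (a : Dir) (F : Finset (Fin 28) → ℝ) :
    (Set.range fun δ₀ : Fin 8 → ℝ => fun p : Fin 8 =>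
      ∑ k, (F (Finset.univ.filter fun l => phiForm δ₀ k / h28 a k ≤ phiForm δ₀ l / h28 a l) -
          F (Finset.univ.filter fun l => phiForm δ₀ k / h28 a k < phiForm δ₀ l / h28 a l)) *
        (phiForm (Pi.single p (1 : ℝ)) k / h28 a k)).Finite := by
  refine (Set.finite_range fun ω : Fin 28 → Finset (Fin 28) × Finset (Fin 28) => fun p : Fin 8 =>
    ∑ k, (F (ω k).1 - F (ω k).2) * (phiForm (Pi.single p (1 : ℝ)) k / h28 a k)).subset ?_
  rintro _ ⟨δ₀, rfl⟩
  exact ⟨fun k => (Finset.univ.filter fun l => phiForm δ₀ k / h28 a k ≤ phiForm δ₀ l / h28 a l,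
    Finset.univ.filter fun l => phiForm δ₀ k / h28 a k < phiForm δ₀ l / h28 a l), rfl⟩

/-- **GORDAN'S ALTERNATIVE FOR THE CHAMBER FUNCTIONALS** (any set function `F` on the 28 forms, any direction `a`).
EITHER there is a displacement `δ` at which EVERY generic reference's chamber functional is positive,
`0 < Σ_k W_k(δ₀)·φ_k(δ)/h_k(a)` for all `δ₀` with pairwise distinct rates — a UNIFORM ascent displacement —, OR the
HULL CERTIFICATE of `cuspSlope_nonpos_of_hull_certificate` EXISTS: finitely many generic references `δ₀ ∈ s` and weights
`t ≥ 0` with `Σ t > 0` and `Σ_{δ₀∈s} t δ₀ · G_{δ₀}(δ) = 0` for every `δ`. (`not_uniform_pos_of_hull_certificate`: not both.) -/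
theorem exists_uniform_ascent_or_hull_certificate (a : Dir) (F : Finset (Fin 28) → ℝ) :
    (∃ δ : Fin 8 → ℝ, ∀ δ₀ : Fin 8 → ℝ,
        (∀ k l : Fin 28, k ≠ l → phiForm δ₀ k / h28 a k ≠ phiForm δ₀ l / h28 a l) →
          0 < ∑ k, (F (Finset.univ.filter fun l => phiForm δ₀ k / h28 a k ≤ phiForm δ₀ l / h28 a l) -
              F (Finset.univ.filter fun l => phiForm δ₀ k / h28 a k < phiForm δ₀ l / h28 a l)) *
            (phiForm δ k / h28 a k)) ∨
      ∃ (s : Finset (Fin 8 → ℝ)) (t : (Fin 8 → ℝ) → ℝ),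
        (∀ δ₀ ∈ s, ∀ k l : Fin 28, k ≠ l → phiForm δ₀ k / h28 a k ≠ phiForm δ₀ l / h28 a l) ∧
          (∀ δ₀ ∈ s, 0 ≤ t δ₀) ∧ 0 < ∑ δ₀ ∈ s, t δ₀ ∧
            ∀ δ : Fin 8 → ℝ, ∑ δ₀ ∈ s, t δ₀ *
              ∑ k, (F (Finset.univ.filter fun l => phiForm δ₀ k / h28 a k ≤ phiForm δ₀ l / h28 a l) -
                  F (Finset.univ.filter fun l => phiForm δ₀ k / h28 a k < phiForm δ₀ l / h28 a l)) *
                (phiForm δ k / h28 a k) = 0 :=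
  gordan_alternative
    (fun δ₀ δ => ∑ k, (F (Finset.univ.filter fun l => phiForm δ₀ k / h28 a k ≤ phiForm δ₀ l / h28 a l) -
        F (Finset.univ.filter fun l => phiForm δ₀ k / h28 a k < phiForm δ₀ l / h28 a l)) * (phiForm δ k / h28 a k))
    (fun δ₀ => ∀ k l : Fin 28, k ≠ l → phiForm δ₀ k / h28 a k ≠ phiForm δ₀ l / h28 a l)
    (fun _ δ => sum_mul_rate_eq_sum_coord a _ δ)
    ((chamber_gradients_finite a F).subset (Set.image_subset_range _ _))

/-! ### The hull condition is necessary at a cusp top — for a period pattern function of ANY type -/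

/-- **AT A CUSP TOP THE HULL CERTIFICATE EXISTS — ANY TYPE.** All 28 forms of `a` positive, `T > 0` a period, `f m` /
`M m` / `F` as in `cuspSlope_eq_lovasz_period` (junction pattern functions agreeing with the saving near each junction, any
extension; `F(A) = Σ_m f m (A ∩ M m)`). If `cuspSlope a T δ ≤ 0` for EVERY displacement `δ`, then there are finitely many
generic references `δ₀ ∈ s` and weights `t ≥ 0`, `Σ t > 0`, with `Σ_{δ₀∈s} t δ₀ · G_{δ₀}(δ) = 0` for every `δ`: zero lies
in the convex hull of the chamber gradients. (Otherwise Gordan's alternative gives a uniform ascent displacement, at which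
`σ > 0` by `cuspSlope_pos_of_forall_greedy_pos`.) For `F` of no pure type this is NECESSARY, not sufficient. -/
theorem hull_certificate_of_forall_cuspSlope_nonpos {a : Dir} (hpos : ∀ k, 0 < h28 a k) {T : ℝ} (hT : 0 < T)
    (hper : ∀ k : Fin 28, ∃ z : ℤ, T * h28 a k = z)
    {M : ℕ → Finset (Fin 28)} {f : ℕ → Finset (Fin 28) → ℝ}
    (hf : ∀ m, m + 1 < (bkpts a T).card → ∀ Δ : Fin 8 → ℝ, (∀ k, |phiForm Δ k| < 1) →
      (∀ k, |phiForm Δ k| < wallDist a T) →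
        (torusN (bkpt a T m • sParam a + Δ) : ℝ) = f m ((M m).filter fun k => 0 ≤ phiForm Δ k))
    {F : Finset (Fin 28) → ℝ} (hF : ∀ A, F A = ∑ m ∈ Finset.range ((bkpts a T).card - 1), f m (A ∩ M m))
    (hnonpos : ∀ δ, cuspSlope a T δ ≤ 0) :
    ∃ (s : Finset (Fin 8 → ℝ)) (t : (Fin 8 → ℝ) → ℝ),
      (∀ δ₀ ∈ s, ∀ k l : Fin 28, k ≠ l → phiForm δ₀ k / h28 a k ≠ phiForm δ₀ l / h28 a l) ∧
        (∀ δ₀ ∈ s, 0 ≤ t δ₀) ∧ 0 < ∑ δ₀ ∈ s, t δ₀ ∧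
          ∀ δ : Fin 8 → ℝ, ∑ δ₀ ∈ s, t δ₀ *
            ∑ k, (F (Finset.univ.filter fun l => phiForm δ₀ k / h28 a k ≤ phiForm δ₀ l / h28 a l) -
                F (Finset.univ.filter fun l => phiForm δ₀ k / h28 a k < phiForm δ₀ l / h28 a l)) *
              (phiForm δ k / h28 a k) = 0 := by
  rcases exists_uniform_ascent_or_hull_certificate a F with ⟨δ, hδ⟩ | h
  · exact absurd (hnonpos δ) (not_le.mpr (cuspSlope_pos_of_forall_greedy_pos hpos hT hper hf hF δ hδ))
  · exact h

/-- **NO UNIFORM ASCENT DISPLACEMENT AT A CUSP TOP** (any type): if `cuspSlope a T δ ≤ 0` for every `δ`, then every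
displacement has SOME generic reference whose chamber functional is `≤ 0` there (read contrapositively:
a displacement ascending in every chamber functional is an ascent direction). -/
theorem exists_greedy_nonpos_of_forall_cuspSlope_nonpos {a : Dir} (hpos : ∀ k, 0 < h28 a k) {T : ℝ} (hT : 0 < T)
    (hper : ∀ k : Fin 28, ∃ z : ℤ, T * h28 a k = z)
    {M : ℕ → Finset (Fin 28)} {f : ℕ → Finset (Fin 28) → ℝ}
    (hf : ∀ m, m + 1 < (bkpts a T).card → ∀ Δ : Fin 8 → ℝ, (∀ k, |phiForm Δ k| < 1) →
      (∀ k, |phiForm Δ k| < wallDist a T) →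
        (torusN (bkpt a T m • sParam a + Δ) : ℝ) = f m ((M m).filter fun k => 0 ≤ phiForm Δ k))
    {F : Finset (Fin 28) → ℝ} (hF : ∀ A, F A = ∑ m ∈ Finset.range ((bkpts a T).card - 1), f m (A ∩ M m))
    (hnonpos : ∀ δ, cuspSlope a T δ ≤ 0) (δ : Fin 8 → ℝ) :
    ∃ δ₀ : Fin 8 → ℝ, (∀ k l : Fin 28, k ≠ l → phiForm δ₀ k / h28 a k ≠ phiForm δ₀ l / h28 a l) ∧
      ∑ k, (F (Finset.univ.filter fun l => phiForm δ₀ k / h28 a k ≤ phiForm δ₀ l / h28 a l) -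
          F (Finset.univ.filter fun l => phiForm δ₀ k / h28 a k < phiForm δ₀ l / h28 a l)) *
        (phiForm δ k / h28 a k) ≤ 0 := by
  obtain ⟨δ₀, hgen, -, hσ⟩ := exists_generic_greedy_eq_cuspSlope hpos hT hper hf hF δ
  exact ⟨δ₀, hgen, hσ ▸ hnonpos δ⟩

/-! ### Gordan's converse: the supermodular period -/

/-- **GORDAN'S CONVERSE — THE HULL CERTIFICATE IS COMPLETE FOR A SUPERMODULAR PERIOD.** With the data of
`cuspSlope_eq_lovasz_period` and `F` supermodular: `cuspSlope a T δ ≤ 0` for EVERY displacement `δ` IF AND ONLY IF there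
are finitely many generic references `δ₀ ∈ s` and weights `t ≥ 0`, `Σ t > 0`, with `Σ_{δ₀∈s} t δ₀ · G_{δ₀} ≡ 0`
(⇐ is P2 g31's `cuspSlope_nonpos_of_hull_certificate`; ⇒ is `hull_certificate_of_forall_cuspSlope_nonpos`, which needs no
type). The hypothesis `hsuper` is never asserted for a named direction (DATA: `F` is of no pure type at the four). -/
theorem forall_cuspSlope_nonpos_iff_hull_certificate_of_supermodular {a : Dir} (hpos : ∀ k, 0 < h28 a k) {T : ℝ}
    (hT : 0 < T) (hper : ∀ k : Fin 28, ∃ z : ℤ, T * h28 a k = z)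
    {M : ℕ → Finset (Fin 28)} {f : ℕ → Finset (Fin 28) → ℝ}
    (hf : ∀ m, m + 1 < (bkpts a T).card → ∀ Δ : Fin 8 → ℝ, (∀ k, |phiForm Δ k| < 1) →
      (∀ k, |phiForm Δ k| < wallDist a T) →
        (torusN (bkpt a T m • sParam a + Δ) : ℝ) = f m ((M m).filter fun k => 0 ≤ phiForm Δ k))
    {F : Finset (Fin 28) → ℝ} (hF : ∀ A, F A = ∑ m ∈ Finset.range ((bkpts a T).card - 1), f m (A ∩ M m))
    (hsuper : ∀ A B : Finset (Fin 28), F A + F B ≤ F (A ∪ B) + F (A ∩ B)) :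
    (∀ δ, cuspSlope a T δ ≤ 0) ↔
      ∃ (s : Finset (Fin 8 → ℝ)) (t : (Fin 8 → ℝ) → ℝ),
        (∀ δ₀ ∈ s, ∀ k l : Fin 28, k ≠ l → phiForm δ₀ k / h28 a k ≠ phiForm δ₀ l / h28 a l) ∧
          (∀ δ₀ ∈ s, 0 ≤ t δ₀) ∧ 0 < ∑ δ₀ ∈ s, t δ₀ ∧
            ∀ δ : Fin 8 → ℝ, ∑ δ₀ ∈ s, t δ₀ *
              ∑ k, (F (Finset.univ.filter fun l => phiForm δ₀ k / h28 a k ≤ phiForm δ₀ l / h28 a l) -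
                  F (Finset.univ.filter fun l => phiForm δ₀ k / h28 a k < phiForm δ₀ l / h28 a l)) *
                (phiForm δ k / h28 a k) = 0 := by
  refine ⟨hull_certificate_of_forall_cuspSlope_nonpos hpos hT hper hf hF, ?_⟩
  rintro ⟨s, t, hgen, ht, htpos, hzero⟩ δ
  exact cuspSlope_nonpos_of_hull_certificate hpos hT hper hf hF hsuper s (fun δ₀ => δ₀) hgen t ht htpos hzero δ

/-- **GORDAN'S ALTERNATIVE FOR THE CUSP SLOPE OF A SUPERMODULAR PERIOD**: EXACTLY ONE of — (i) some displacement is an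
ascent direction (`0 < cuspSlope a T δ`); (ii) the hull certificate exists. Stated as: an ascent direction exists iff NO
hull certificate does. -/
theorem exists_ascent_iff_no_hull_certificate_of_supermodular {a : Dir} (hpos : ∀ k, 0 < h28 a k) {T : ℝ}
    (hT : 0 < T) (hper : ∀ k : Fin 28, ∃ z : ℤ, T * h28 a k = z)
    {M : ℕ → Finset (Fin 28)} {f : ℕ → Finset (Fin 28) → ℝ}
    (hf : ∀ m, m + 1 < (bkpts a T).card → ∀ Δ : Fin 8 → ℝ, (∀ k, |phiForm Δ k| < 1) →
      (∀ k, |phiForm Δ k| < wallDist a T) →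
        (torusN (bkpt a T m • sParam a + Δ) : ℝ) = f m ((M m).filter fun k => 0 ≤ phiForm Δ k))
    {F : Finset (Fin 28) → ℝ} (hF : ∀ A, F A = ∑ m ∈ Finset.range ((bkpts a T).card - 1), f m (A ∩ M m))
    (hsuper : ∀ A B : Finset (Fin 28), F A + F B ≤ F (A ∪ B) + F (A ∩ B)) :
    (∃ δ, 0 < cuspSlope a T δ) ↔
      ¬ ∃ (s : Finset (Fin 8 → ℝ)) (t : (Fin 8 → ℝ) → ℝ),
        (∀ δ₀ ∈ s, ∀ k l : Fin 28, k ≠ l → phiForm δ₀ k / h28 a k ≠ phiForm δ₀ l / h28 a l) ∧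
          (∀ δ₀ ∈ s, 0 ≤ t δ₀) ∧ 0 < ∑ δ₀ ∈ s, t δ₀ ∧
            ∀ δ : Fin 8 → ℝ, ∑ δ₀ ∈ s, t δ₀ *
              ∑ k, (F (Finset.univ.filter fun l => phiForm δ₀ k / h28 a k ≤ phiForm δ₀ l / h28 a l) -
                  F (Finset.univ.filter fun l => phiForm δ₀ k / h28 a k < phiForm δ₀ l / h28 a l)) *
                (phiForm δ k / h28 a k) = 0 := by
  rw [← forall_cuspSlope_nonpos_iff_hull_certificate_of_supermodular hpos hT hper hf hF hsuper]
  constructor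
  · rintro ⟨δ, hδ⟩ h
    exact (h δ).not_gt hδ
  · intro h
    by_contra hc
    push Not at hc
    exact h hc

end Summit.KontsevichZagierPeriods.Zeta5Search.Barrier.ConeGamma

end
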